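import Mathlib
import Summits.NavierStokesRegularity.FluidComputer.APosterioriInverseBound

/-!
# Certifier norm bounds: weighted Schur test / Collatz–Wielandt, the 3-B back-substitution constant, disc transport of a resolvent bound, and factorisation-residual eigenvalue bounds (profile-cert-3 g3, cell `ns-blowup`, 2026-08-26)

HONEST FRAMING (human rulings D-0035/D-0074): nothing here is a claim about Navier–Stokes blow-up.
WHAT THIS IS NOT: not NS evidence. These are the generic linear-algebra / normed-ring facts that the
F5 eigenpair and resolvent certifiers of GROUP B (`HOME/profile/cert/impl1` python-flint, `impl2` numpy
mid–rad, `impl3` ulp-intervals; rows of `CertificateAbcSpectrum*`, `CertificateAbcResolvent*`) use to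
turn their interval outputs into the constants of THEOREM 3-B of `instab/CERT-ROPE-X0.md` (REFEREE A19
PASS) and of its unbordered resolvent form (cap `SKEWCUT-PAIR.md` §9, cert-1 `NONRESONANCE-impl1.md`
Theorem R), complementing `BorderedEigenpairCertificate` (K-B1–K-B3), `BorderedEigenpairFixedPoint`
(K-B4–K-B7), `APosterioriInverseBound` (`‖Â₀⁻¹‖ ≤ ‖X̃‖/(1 − θ)`) and `TwoSidedResidualEnclosure`
(real Cholesky route). After this file the only non-kernel links of a 3-B / resolvent row are (i) the
outward-rounding claims of each program's arithmetic (that the printed interval endpoints enclose the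
real numbers they name), (ii) the Lax–Milgram step on the Fourier tail and the compact-resolvent facts
(paper-grade, CERT-ROPE-X0 §B (a)/(c)), (iii) the model-specific assembly (SKEWCUT-CERT (F1)–(F4)).

* §1 `sum_norm_sq_mulVec_le_of_weightedSchur`, `l2_opNorm_le_of_weightedSchur` — the WEIGHTED SCHUR
  TEST for a rectangular matrix over `ℝ`/`ℂ` in the `ℓ²`-operator norm: row sums `Σ_j |a_ij| q_j ≤ c₁ p_i`
  and column sums `Σ_i |a_ij| p_i ≤ c₂ q_j` (`q > 0`) give `‖A‖₂ ≤ √(c₁c₂)`. Corollaries: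
  `l2_opNorm_le_sqrt_rowSum_mul_colSum` (`‖A‖₂² ≤ ‖A‖_∞‖A‖₁`, the bound behind impl-3's
  `θ = √(‖E‖₁‖E‖_∞)` and its block norms, and behind (N3) of SKEWCUT-PAIR §9) and
  `l2_opNorm_le_of_collatzWielandt` (`|A|ᵀ(|A|w) ≤ c·w` for ONE positive test vector `w` ⇒ `‖A‖₂ ≤ √c`:
  impl-3's `‖X̃‖₂` and impl-1's (c4) `α₀` bound; the float Perron vector is only a proposal).
* §2 `sq_add_sq_le_backSubst`, `WithLp.norm_le_backSubst_mul_norm`,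
  `ContinuousLinearMap.opNorm_le_backSubst` — the BACK-SUBSTITUTION CONSTANT of 3-B (a) STEP 3 /
  Theorem R: if the tail and head components of a solution obey `‖u_T‖ ≤ (‖f_T‖ + β_C‖f_h‖)/μ` and
  `‖u_h‖ ≤ α‖f_h‖ + β_B‖u_T‖`, then in the `ℓ²`-product norm `‖u‖ ≤ M‖f‖` with
  `M = √((1 + β_C²)/μ² + (α + β_B√(1 + β_C²)/μ)²)` — exactly the printed `M₀` of every row.
* §3 `Units.norm_inv_oneSub_le`, `exists_unit_one_add_mul`, `resolvent_disc_transport` — DISC TRANSPORT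
  of an inverse bound in a Banach algebra: `‖(z₀ − L)⁻¹‖ ≤ M` and `|z − z₀| ≤ δ` with `Mδ < 1` ⇒ `z − L`
  invertible with `‖(z − L)⁻¹‖ ≤ M/(1 − Mδ)` (the `Mdisc`/`deltaMax` columns of the resolvent rows; for
  the unbounded model operator the same identity `z − L = (1 + (z − z₀)R)(z₀ − L)` is read on `D(L)`).
* §4 `re_quadForm_ge_neg_of_factor_residual` and the two shifted corollaries — the FACTORISATION-RESIDUAL
  eigenvalue certificates over `ℝ`/`ℂ`: `P = LLᴴ + E`, `‖E‖₂ ≤ ε` ⇒ `Re⟨v, Pv⟩ ≥ −ε‖v‖²`; hence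
  `λ_min(s·1 + P) ≥ s − ε` and `λ_max(s·1 − P) ≤ s + ε` in quadratic-form language (impl-3's `[MU2]`,
  `[Gram_B]`, `[Gram_C]` certificates: float Cholesky proposal `L`, interval residual `E`; the real,
  norm-free core is `TwoSidedResidualEnclosure.quadForm_ge_neg_of_factor`).

Mathlib + `APosterioriInverseBound` only; no new definitions. bears_on LADDER-NS N5 / Z4-a(1)(2) (F5
certificate rigour); evidence-only for route item `EpisodeBase` (stmt-NavierStokesRegularity-19179).
-/

open scoped Matrix.Norms.L2Operator
open Matrix WithLp Finset

namespace Summit.NavierStokesRegularity.FluidComputer.CertifierNormBounds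

/-! ## §1 Weighted Schur test and Collatz–Wielandt in the `ℓ²`-operator norm -/

section Schur

variable {𝕜 : Type*} [RCLike 𝕜] {m n : Type*} [Fintype m] [Fintype n]

/-- **Weighted Schur test, sum form.** For a rectangular matrix `A` over `ℝ` or `ℂ`, weights
`p : m → ℝ`, `q : n → ℝ` with `q > 0`, and constants with `Σ_j ‖A i j‖ q_j ≤ c₁ p_i` for every row and
`Σ_i ‖A i j‖ p_i ≤ c₂ q_j` for every column (`c₁ ≥ 0`): `Σ_i ‖(A x)_i‖² ≤ c₁ c₂ Σ_j ‖x_j‖²` for every `x`.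
(Cauchy–Schwarz with the weights `q` inside each row, then the column hypothesis after exchanging the
sums.) [folklore] -/
theorem sum_norm_sq_mulVec_le_of_weightedSchur (A : Matrix m n 𝕜) (x : n → 𝕜) (p : m → ℝ)
    (q : n → ℝ) (hq : ∀ j, 0 < q j) {c₁ c₂ : ℝ} (hc₁ : 0 ≤ c₁)
    (hrow : ∀ i, ∑ j, ‖A i j‖ * q j ≤ c₁ * p i) (hcol : ∀ j, ∑ i, ‖A i j‖ * p i ≤ c₂ * q j) :
    ∑ i, ‖(A *ᵥ x) i‖ ^ 2 ≤ c₁ * c₂ * ∑ j, ‖x j‖ ^ 2 := by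
  -- pointwise: ‖(A x)_i‖ ≤ ∑_j ‖A i j‖ ‖x j‖
  have h1 : ∀ i, ‖(A *ᵥ x) i‖ ≤ ∑ j, ‖A i j‖ * ‖x j‖ := by
    intro i
    simp only [Matrix.mulVec, dotProduct]
    exact (norm_sum_le _ _).trans (le_of_eq (by simp [norm_mul]))
  -- weighted Cauchy–Schwarz: (∑_j ‖A i j‖ ‖x j‖)² ≤ (∑_j ‖A i j‖ q_j) (∑_j ‖A i j‖ ‖x j‖² / q_j)
  have h2 : ∀ i, (∑ j, ‖A i j‖ * ‖x j‖) ^ 2 ≤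
      (∑ j, ‖A i j‖ * q j) * (∑ j, ‖A i j‖ * ‖x j‖ ^ 2 / q j) := by
    intro i
    refine Finset.sum_sq_le_sum_mul_sum_of_sq_le_mul _ (fun j _ => by positivity [hq j])
      (fun j _ => by have := hq j; positivity) (fun j _ => le_of_eq ?_)
    have hqj := (hq j).ne'
    field_simp
  have h3 : ∀ i, ‖(A *ᵥ x) i‖ ^ 2 ≤ c₁ * p i * (∑ j, ‖A i j‖ * ‖x j‖ ^ 2 / q j) := by
    intro i
    have hnn : 0 ≤ ∑ j, ‖A i j‖ * ‖x j‖ ^ 2 / q j :=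
      Finset.sum_nonneg fun j _ => by have := hq j; positivity
    calc ‖(A *ᵥ x) i‖ ^ 2 ≤ (∑ j, ‖A i j‖ * ‖x j‖) ^ 2 := by
            gcongr; exact h1 i
      _ ≤ (∑ j, ‖A i j‖ * q j) * (∑ j, ‖A i j‖ * ‖x j‖ ^ 2 / q j) := h2 i
      _ ≤ c₁ * p i * (∑ j, ‖A i j‖ * ‖x j‖ ^ 2 / q j) := by
            gcongr; exact hrow i
  have h4 : ∀ j, ‖x j‖ ^ 2 / q j * ∑ i, ‖A i j‖ * p i ≤ ‖x j‖ ^ 2 / q j * (c₂ * q j) := by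
    intro j
    have := hq j
    gcongr
    exact hcol j
  calc ∑ i, ‖(A *ᵥ x) i‖ ^ 2 ≤ ∑ i, c₁ * p i * (∑ j, ‖A i j‖ * ‖x j‖ ^ 2 / q j) :=
          Finset.sum_le_sum fun i _ => h3 i
    _ = c₁ * ∑ j, (‖x j‖ ^ 2 / q j) * ∑ i, ‖A i j‖ * p i := by
          simp only [Finset.mul_sum]
          rw [Finset.sum_comm]
          refine Finset.sum_congr rfl fun j _ => Finset.sum_congr rfl fun i _ => ?_
          ring
    _ ≤ c₁ * ∑ j, (‖x j‖ ^ 2 / q j) * (c₂ * q j) :=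
          mul_le_mul_of_nonneg_left (Finset.sum_le_sum fun j _ => h4 j) hc₁
    _ = c₁ * c₂ * ∑ j, ‖x j‖ ^ 2 := by
          rw [mul_assoc, Finset.mul_sum (s := Finset.univ) (f := fun j => ‖x j‖ ^ 2)]
          congr 1
          refine Finset.sum_congr rfl fun j _ => ?_
          have hqj := (hq j).ne'
          field_simp

variable [DecidableEq n]

/-- **Weighted Schur test, operator-norm form** (scope `Matrix.Norms.L2Operator`): under the row/column
hypotheses of `sum_norm_sq_mulVec_le_of_weightedSchur` (`q > 0`, `c₁, c₂ ≥ 0`), `‖A‖₂ ≤ √(c₁ c₂)`.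
[folklore] -/
theorem l2_opNorm_le_of_weightedSchur (A : Matrix m n 𝕜) (p : m → ℝ) (q : n → ℝ)
    (hq : ∀ j, 0 < q j) {c₁ c₂ : ℝ} (hc₁ : 0 ≤ c₁) (hc₂ : 0 ≤ c₂)
    (hrow : ∀ i, ∑ j, ‖A i j‖ * q j ≤ c₁ * p i) (hcol : ∀ j, ∑ i, ‖A i j‖ * p i ≤ c₂ * q j) :
    ‖A‖ ≤ √(c₁ * c₂) := by
  rw [Matrix.l2_opNorm_def]
  refine ContinuousLinearMap.opNorm_le_bound _ (Real.sqrt_nonneg _) fun v => ?_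
  change ‖(toEuclideanLin A) v‖ ≤ _
  rw [EuclideanSpace.norm_eq, EuclideanSpace.norm_eq, ← Real.sqrt_mul (mul_nonneg hc₁ hc₂)]
  refine Real.sqrt_le_sqrt ?_
  have h := sum_norm_sq_mulVec_le_of_weightedSchur A v.ofLp p q hq hc₁ hrow hcol
  have hcoord : ∀ i, ((toEuclideanLin A) v).ofLp i = (A *ᵥ v.ofLp) i := fun i => rfl
  simp_rw [hcoord]
  exact h

/-- **`‖A‖₂² ≤ ‖A‖_∞ · ‖A‖₁`** (unweighted Schur / Riesz–Thorin endpoint): if every row sum of `‖A i j‖`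
is `≤ R` and every column sum is `≤ C` (`R, C ≥ 0`) then `‖A‖₂ ≤ √(R C)`. This is the inequality behind
the certifiers' `θ = √(‖I − X̃Â₀‖₁ ‖I − X̃Â₀‖_∞) ≥ ‖I − X̃Â₀‖₂` and the `√(‖·‖₁‖·‖_∞)` block-norm bounds
(SKEWCUT-PAIR §9 (N3); impl-3 `cert3.py`). [folklore] -/
theorem l2_opNorm_le_sqrt_rowSum_mul_colSum (A : Matrix m n 𝕜) {R C : ℝ} (hR : 0 ≤ R) (hC : 0 ≤ C)
    (hrow : ∀ i, ∑ j, ‖A i j‖ ≤ R) (hcol : ∀ j, ∑ i, ‖A i j‖ ≤ C) : ‖A‖ ≤ √(R * C) := by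
  refine l2_opNorm_le_of_weightedSchur A (fun _ => 1) (fun _ => 1) (fun _ => one_pos) hR hC ?_ ?_
  · intro i; simpa using hrow i
  · intro j; simpa using hcol j

/-- **Collatz–Wielandt bound for the spectral norm.** For ONE entrywise positive test vector `w` with
`(|A|ᵀ(|A| w))_j ≤ c · w_j` for every `j` (`c ≥ 0`), `‖A‖₂ ≤ √c`. (Schur's test with the weights
`p = |A| w`, `q = w`; no Perron–Frobenius theory is needed, and nothing is assumed about how `w` was
found — a poor `w` only makes `c` large.) This is impl-3's `‖X̃‖₂` certificate and impl-1's (c4)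
`α₀` route (cert `PLAN.md` §3 M2 (c4)). [folklore] -/
theorem l2_opNorm_le_of_collatzWielandt (A : Matrix m n 𝕜) (w : n → ℝ) (hw : ∀ j, 0 < w j)
    {c : ℝ} (hc : 0 ≤ c)
    (h : ∀ j, ∑ i, ‖A i j‖ * (∑ j', ‖A i j'‖ * w j') ≤ c * w j) : ‖A‖ ≤ √c := by
  have := l2_opNorm_le_of_weightedSchur A (fun i => ∑ j', ‖A i j'‖ * w j') w hw zero_le_one hc
    (fun i => by simp) h
  simpa using this

end Schur

/-! ## §2 The back-substitution constant of THEOREM 3-B (a) STEP 3 / Theorem R -/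

section BackSubst

/-- **Back-substitution bound, scalar form.** If nonnegative reals satisfy
`u_T ≤ (b + β_C a)/μ` (tail solve: Lax–Milgram with constant `μ > 0`, right side `f_T − ĈÂ⁻¹f_h`,
`‖ĈÂ⁻¹‖ ≤ β_C`) and `u_h ≤ α a + β_B u_T` (head back-substitution `u_h = Â⁻¹(f_h − B̂u_T)`,
`‖Â⁻¹‖ ≤ α`, `‖Â⁻¹B̂‖ ≤ β_B`), then
`u_h² + u_T² ≤ [(1 + β_C²)/μ² + (α + β_B√(1 + β_C²)/μ)²]·(a² + b²)` — the square of the printed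
constant `M₀` of every 3-B row (CERT-ROPE-X0 §B: «with ‖f_h‖² + ‖f_T‖² = 1 and Cauchy–Schwarz … the two
bounds give ‖x‖ ≤ M»). [folklore] -/
theorem sq_add_sq_le_backSubst {a b uh uT α βB βC μ : ℝ} (hμ : 0 < μ) (ha : 0 ≤ a) (hb : 0 ≤ b)
    (huh : 0 ≤ uh) (huT : 0 ≤ uT) (hα : 0 ≤ α) (hβB : 0 ≤ βB) (hβC : 0 ≤ βC)
    (hT : uT ≤ (b + βC * a) / μ) (hH : uh ≤ α * a + βB * uT) :
    uh ^ 2 + uT ^ 2 ≤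
      ((1 + βC ^ 2) / μ ^ 2 + (α + βB * √(1 + βC ^ 2) / μ) ^ 2) * (a ^ 2 + b ^ 2) := by
  set S := √(1 + βC ^ 2) with hSdef
  set N := √(a ^ 2 + b ^ 2) with hNdef
  have hS : 0 ≤ S := Real.sqrt_nonneg _
  have hN : 0 ≤ N := Real.sqrt_nonneg _
  have hS2 : S ^ 2 = 1 + βC ^ 2 := Real.sq_sqrt (by positivity)
  have hN2 : N ^ 2 = a ^ 2 + b ^ 2 := Real.sq_sqrt (by positivity)
  -- Cauchy–Schwarz in the plane: b + β_C a ≤ √(1 + β_C²) √(a² + b²)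
  have key : b + βC * a ≤ S * N := by
    have h0 : 0 ≤ b + βC * a := by positivity
    have hsq : (b + βC * a) ^ 2 ≤ (S * N) ^ 2 := by
      rw [mul_pow, hS2, hN2]; nlinarith [sq_nonneg (a - βC * b)]
    exact (pow_le_pow_iff_left₀ h0 (by positivity) two_ne_zero).mp hsq
  have hU : uT ≤ S * N / μ := hT.trans (div_le_div_of_nonneg_right key hμ.le)
  have haN : a ≤ N := by
    have : a ^ 2 ≤ N ^ 2 := by rw [hN2]; nlinarith
    exact (pow_le_pow_iff_left₀ ha hN two_ne_zero).mp this
  have hHle : uh ≤ α * N + βB * (S * N / μ) :=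
    hH.trans (add_le_add (mul_le_mul_of_nonneg_left haN hα) (mul_le_mul_of_nonneg_left hU hβB))
  have h1 : uh ^ 2 ≤ (α * N + βB * (S * N / μ)) ^ 2 := pow_le_pow_left₀ huh hHle 2
  have h2 : uT ^ 2 ≤ (S * N / μ) ^ 2 := pow_le_pow_left₀ huT hU 2
  rw [← hS2, ← hN2]
  calc uh ^ 2 + uT ^ 2 ≤ (α * N + βB * (S * N / μ)) ^ 2 + (S * N / μ) ^ 2 := add_le_add h1 h2
    _ = (S ^ 2 / μ ^ 2 + (α + βB * S / μ) ^ 2) * N ^ 2 := by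
        field_simp
        ring

variable {E F E' F' : Type*} [SeminormedAddCommGroup E] [SeminormedAddCommGroup F]
  [SeminormedAddCommGroup E'] [SeminormedAddCommGroup F']

/-- **Back-substitution bound in the `ℓ²`-product norm.** For `x = (f_h, f_T)` and `y = (u_h, u_T)` in
`ℓ²`-products of seminormed groups (`‖(w, μ)‖² = ‖w‖² + ‖μ‖²`, the augmented space `Ĥ = (Π_{K₀}H × ℂ) ⊕ T`
of 3-B): the two component bounds of `sq_add_sq_le_backSubst` give `‖y‖ ≤ M₀ ‖x‖`. [folklore] -/
theorem WithLp.norm_le_backSubst_mul_norm (x : WithLp 2 (E × F)) (y : WithLp 2 (E' × F'))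
    {α βB βC μ : ℝ} (hμ : 0 < μ) (hα : 0 ≤ α) (hβB : 0 ≤ βB) (hβC : 0 ≤ βC)
    (hT : ‖y.snd‖ ≤ (‖x.snd‖ + βC * ‖x.fst‖) / μ) (hH : ‖y.fst‖ ≤ α * ‖x.fst‖ + βB * ‖y.snd‖) :
    ‖y‖ ≤ √((1 + βC ^ 2) / μ ^ 2 + (α + βB * √(1 + βC ^ 2) / μ) ^ 2) * ‖x‖ := by
  have hM : 0 ≤ (1 + βC ^ 2) / μ ^ 2 + (α + βB * √(1 + βC ^ 2) / μ) ^ 2 := by positivity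
  rw [WithLp.prod_norm_eq_of_L2 x, WithLp.prod_norm_eq_of_L2 y, ← Real.sqrt_mul hM]
  refine Real.sqrt_le_sqrt ?_
  exact sq_add_sq_le_backSubst hμ (norm_nonneg _) (norm_nonneg _) (norm_nonneg _) (norm_nonneg _)
    hα hβB hβC hT hH

variable {𝕜 : Type*} [NontriviallyNormedField 𝕜] [NormedSpace 𝕜 E] [NormedSpace 𝕜 F]
  [NormedSpace 𝕜 E'] [NormedSpace 𝕜 F']

/-- **3-B (a), last sentence / Theorem R's `M`: operator-norm form.** A continuous linear map `T`
between `ℓ²`-products (in 3-B: `T = 𝔅⁻¹`, head `E' = Π_{K₀}H × ℂ`, tail `F' = T`) whose tail component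
obeys `‖(T x)_T‖ ≤ (‖x_T‖ + β_C‖x_h‖)/μ` and whose head component obeys
`‖(T x)_h‖ ≤ α‖x_h‖ + β_B‖(T x)_T‖` has `‖T‖ ≤ M₀ = √((1 + β_C²)/μ² + (α + β_B√(1 + β_C²)/μ)²)`.
[folklore] -/
theorem ContinuousLinearMap.opNorm_le_backSubst (T : WithLp 2 (E × F) →L[𝕜] WithLp 2 (E' × F'))
    {α βB βC μ : ℝ} (hμ : 0 < μ) (hα : 0 ≤ α) (hβB : 0 ≤ βB) (hβC : 0 ≤ βC)
    (hT : ∀ x, ‖(T x).snd‖ ≤ (‖x.snd‖ + βC * ‖x.fst‖) / μ)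
    (hH : ∀ x, ‖(T x).fst‖ ≤ α * ‖x.fst‖ + βB * ‖(T x).snd‖) :
    ‖T‖ ≤ √((1 + βC ^ 2) / μ ^ 2 + (α + βB * √(1 + βC ^ 2) / μ) ^ 2) :=
  ContinuousLinearMap.opNorm_le_bound _ (Real.sqrt_nonneg _) fun x =>
    WithLp.norm_le_backSubst_mul_norm x (T x) hμ hα hβB hβC (hT x) (hH x)

end BackSubst

/-! ## §3 Disc transport of an inverse / resolvent bound (Neumann series) -/

section DiscTransport

open Summit.NavierStokesRegularity.FluidComputer.APosterioriInverseBound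

variable {A : Type*} [NormedRing A] [NormOneClass A] [HasSummableGeomSeries A]

/-- Neumann bound for Mathlib's unit `Units.oneSub t h = 1 − t` (`‖t‖ < 1`): `‖(1 − t)⁻¹‖ ≤ 1/(1 − ‖t‖)`
(via `APosterioriInverseBound.Units.norm_inv_le` with the proposal `r = 1`). [folklore] -/
theorem Units.norm_inv_oneSub_le (t : A) (h : ‖t‖ < 1) :
    ‖(↑(Units.oneSub t h)⁻¹ : A)‖ ≤ 1 / (1 - ‖t‖) := by
  have h1 : ‖1 - (1 : A) * ↑(Units.oneSub t h)‖ = ‖t‖ := by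
    rw [Units.val_oneSub, one_mul, sub_sub_cancel]
  have h2 := Units.norm_inv_le (Units.oneSub t h) (1 : A) (by rw [h1]; exact h)
  rwa [h1, norm_one] at h2

/-- **Disc transport, ring form.** If `‖R‖ ≤ M`, `‖e‖ ≤ δ` (`δ ≥ 0`) and `Mδ < 1`, then `1 + eR` is a
unit `u` with `‖u⁻¹‖ ≤ 1/(1 − Mδ)` and `‖R u⁻¹‖, ‖u⁻¹ R‖ ≤ M/(1 − Mδ)`. [folklore] -/
theorem exists_unit_one_add_mul (R e : A) {M δ : ℝ} (hR : ‖R‖ ≤ M) (he : ‖e‖ ≤ δ) (hδ : 0 ≤ δ)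
    (hMδ : M * δ < 1) :
    ∃ u : Aˣ, (u : A) = 1 + e * R ∧ ‖(↑u⁻¹ : A)‖ ≤ 1 / (1 - M * δ) ∧
      ‖R * (↑u⁻¹ : A)‖ ≤ M / (1 - M * δ) ∧ ‖(↑u⁻¹ : A) * R‖ ≤ M / (1 - M * δ) := by
  have hM : 0 ≤ M := (norm_nonneg R).trans hR
  have ht : ‖-(e * R)‖ ≤ M * δ := by
    rw [norm_neg]
    refine (norm_mul_le _ _).trans ?_
    calc ‖e‖ * ‖R‖ ≤ δ * M := mul_le_mul he hR (norm_nonneg _) hδ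
      _ = M * δ := mul_comm _ _
  have ht1 : ‖-(e * R)‖ < 1 := ht.trans_lt hMδ
  have hu : ‖(↑(Units.oneSub _ ht1)⁻¹ : A)‖ ≤ 1 / (1 - M * δ) :=
    (Units.norm_inv_oneSub_le _ ht1).trans
      (div_le_div_of_nonneg_left zero_le_one (by linarith) (by linarith))
  refine ⟨Units.oneSub _ ht1, by rw [Units.val_oneSub, sub_neg_eq_add], hu, ?_, ?_⟩
  · calc ‖R * (↑(Units.oneSub _ ht1)⁻¹ : A)‖
          ≤ ‖R‖ * ‖(↑(Units.oneSub _ ht1)⁻¹ : A)‖ := norm_mul_le _ _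
      _ ≤ M * (1 / (1 - M * δ)) := mul_le_mul hR hu (norm_nonneg _) hM
      _ = M / (1 - M * δ) := by ring
  · calc ‖(↑(Units.oneSub _ ht1)⁻¹ : A) * R‖
          ≤ ‖(↑(Units.oneSub _ ht1)⁻¹ : A)‖ * ‖R‖ := norm_mul_le _ _
      _ ≤ (1 / (1 - M * δ)) * M := mul_le_mul hu hR (norm_nonneg _) (by positivity)
      _ = M / (1 - M * δ) := by ring

variable {𝕜 : Type*} [NormedField 𝕜] [NormedAlgebra 𝕜 A]

/-- **Disc transport, resolvent form** (the `Mdisc = M/(1 − Mδ)` and `δ_max = 1/M` columns of the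
resolvent rows `CertificateAbcResolvent*`): in a Banach algebra with `‖1‖ = 1`, if `R` is a two-sided
inverse of `z₀ − L` with `‖R‖ ≤ M`, and `|z − z₀| ≤ δ` with `Mδ < 1`, then `z − L` is invertible and
`‖(z − L)⁻¹‖ ≤ M/(1 − Mδ)`; indeed `z − L = (1 + (z − z₀)R)(z₀ − L)` and `(z − L)⁻¹ = R(1 + (z − z₀)R)⁻¹`.
(For the unbounded model operator the same two identities are read on `D(L)` with `R ∈ B(H)`; every
Galerkin section is the literal bounded case.) [folklore] -/
theorem resolvent_disc_transport (L R : A) (z₀ z : 𝕜) {M δ : ℝ}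
    (hinv₁ : (algebraMap 𝕜 A z₀ - L) * R = 1) (hinv₂ : R * (algebraMap 𝕜 A z₀ - L) = 1)
    (hR : ‖R‖ ≤ M) (hz : ‖z - z₀‖ ≤ δ) (hMδ : M * δ < 1) :
    IsUnit (algebraMap 𝕜 A z - L) ∧ ‖Ring.inverse (algebraMap 𝕜 A z - L)‖ ≤ M / (1 - M * δ) := by
  have hδ : 0 ≤ δ := (norm_nonneg _).trans hz
  set e : A := algebraMap 𝕜 A (z - z₀) with he
  have hne : ‖e‖ ≤ δ := by rw [he, norm_algebraMap']; exact hz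
  obtain ⟨w, hwval, -, hRw, -⟩ := exists_unit_one_add_mul R e hR hne hδ hMδ
  set v : Aˣ := ⟨algebraMap 𝕜 A z₀ - L, R, hinv₁, hinv₂⟩ with hv
  have hprod : ((w * v : Aˣ) : A) = algebraMap 𝕜 A z - L := by
    rw [Units.val_mul, hwval]
    change (1 + e * R) * (algebraMap 𝕜 A z₀ - L) = _
    rw [add_mul, one_mul, mul_assoc, hinv₂, mul_one, he, map_sub]
    abel
  refine ⟨⟨w * v, hprod⟩, ?_⟩
  rw [← hprod, Ring.inverse_unit, _root_.mul_inv_rev, Units.val_mul]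
  exact hRw

end DiscTransport

/-! ## §4 Factorisation-residual eigenvalue certificates (float Cholesky proposal + interval residual) -/

section FactorResidual

variable {𝕜 : Type*} [RCLike 𝕜] {n : Type*} [Fintype n]

/-- `Re (v† v) = Σ ‖v_i‖²`. [folklore] -/
theorem re_star_dotProduct_self (v : n → 𝕜) : RCLike.re (star v ⬝ᵥ v) = ∑ i, ‖v i‖ ^ 2 := by
  simp only [dotProduct, Pi.star_apply, map_sum]
  refine Finset.sum_congr rfl fun i _ => ?_
  rw [RCLike.star_def, RCLike.conj_mul, ← RCLike.ofReal_pow, RCLike.ofReal_re]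

variable [DecidableEq n]

omit [DecidableEq n] in
/-- The Hermitian square is positive: `Re (v† (L Lᴴ) v) = Σ ‖(Lᴴv)_i‖² ≥ 0`. [folklore] -/
theorem re_quadForm_mul_conjTranspose_nonneg (L : Matrix n n 𝕜) (v : n → 𝕜) :
    0 ≤ RCLike.re (star v ⬝ᵥ (L * Lᴴ) *ᵥ v) := by
  rw [← mulVec_mulVec, dotProduct_mulVec, ← conjTranspose_conjTranspose L, ← star_mulVec,
    conjTranspose_conjTranspose, re_star_dotProduct_self]
  exact Finset.sum_nonneg fun i _ => by positivity

/-- Cauchy–Schwarz with the `ℓ²`-operator norm: `|Re (v† E v)| ≤ ‖E‖₂ Σ ‖v_i‖²`. [folklore] -/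
theorem abs_re_quadForm_le_l2_opNorm (E : Matrix n n 𝕜) (v : n → 𝕜) :
    |RCLike.re (star v ⬝ᵥ E *ᵥ v)| ≤ ‖E‖ * ∑ i, ‖v i‖ ^ 2 := by
  set x : EuclideanSpace 𝕜 n := toLp 2 v with hx
  set y : EuclideanSpace 𝕜 n := toLp 2 (E *ᵥ v) with hy
  have h1 : star v ⬝ᵥ E *ᵥ v = inner 𝕜 x y := by
    rw [EuclideanSpace.inner_eq_star_dotProduct, dotProduct_comm]
  have h2 : ‖y‖ ≤ ‖E‖ * ‖x‖ := Matrix.l2_opNorm_mulVec E x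
  have h3 : ‖x‖ ^ 2 = ∑ i, ‖v i‖ ^ 2 := by rw [hx, EuclideanSpace.norm_sq_eq]
  rw [h1, ← h3]
  calc |RCLike.re (inner 𝕜 x y)| ≤ ‖inner 𝕜 x y‖ := RCLike.abs_re_le_norm _
    _ ≤ ‖x‖ * ‖y‖ := norm_inner_le_norm x y
    _ ≤ ‖x‖ * (‖E‖ * ‖x‖) := mul_le_mul_of_nonneg_left h2 (norm_nonneg _)
    _ = ‖E‖ * ‖x‖ ^ 2 := by ring

/-- **Factorisation with residual ⇒ lower bound of the quadratic form.** If `P = L Lᴴ + E` (a float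
Cholesky-type proposal `L` for `P` and its exactly enclosed residual `E`) and `‖E‖₂ ≤ ε`, then
`Re (v† P v) ≥ −ε Σ‖v_i‖²` for every `v`. (Real, norm-free core:
`TwoSidedResidualEnclosure.quadForm_ge_neg_of_factor`.) [folklore] -/
theorem re_quadForm_ge_neg_of_factor_residual (P L E : Matrix n n 𝕜) {ε : ℝ}
    (hfac : P = L * Lᴴ + E) (hE : ‖E‖ ≤ ε) (v : n → 𝕜) :
    -(ε * ∑ i, ‖v i‖ ^ 2) ≤ RCLike.re (star v ⬝ᵥ P *ᵥ v) := by
  rw [hfac, add_mulVec, dotProduct_add, map_add]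
  have h1 := re_quadForm_mul_conjTranspose_nonneg L v
  have h2 := abs_re_quadForm_le_l2_opNorm E v
  have h3 : ‖E‖ * ∑ i, ‖v i‖ ^ 2 ≤ ε * ∑ i, ‖v i‖ ^ 2 :=
    mul_le_mul_of_nonneg_right hE (Finset.sum_nonneg fun i _ => by positivity)
  have h4 := (abs_le.mp (h2.trans h3)).1
  linarith

/-- The scalar shift: `Re (v† (s·1) v) = s Σ‖v_i‖²` for real `s`. [folklore] -/
theorem re_quadForm_smul_one (s : ℝ) (v : n → 𝕜) :
    RCLike.re (star v ⬝ᵥ ((s : 𝕜) • (1 : Matrix n n 𝕜)) *ᵥ v) = s * ∑ i, ‖v i‖ ^ 2 := by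
  rw [Matrix.smul_mulVec, one_mulVec, dotProduct_smul, smul_eq_mul, RCLike.re_ofReal_mul,
    re_star_dotProduct_self]

/-- **Certified `λ_min`** (impl-3 `[MU2]`): `H = s·1 + L Lᴴ + E` with `s` real and `‖E‖₂ ≤ ε` ⇒
`Re (v† H v) ≥ (s − ε) Σ‖v_i‖²`, i.e. `λ_min(H) ≥ s − ε` for Hermitian `H`. [folklore] -/
theorem re_quadForm_ge_of_shift_factor_residual (H L E : Matrix n n 𝕜) {s ε : ℝ}
    (hfac : H = ((s : 𝕜) • (1 : Matrix n n 𝕜)) + L * Lᴴ + E) (hE : ‖E‖ ≤ ε) (v : n → 𝕜) :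
    (s - ε) * ∑ i, ‖v i‖ ^ 2 ≤ RCLike.re (star v ⬝ᵥ H *ᵥ v) := by
  have h := re_quadForm_ge_neg_of_factor_residual (H - (s : 𝕜) • (1 : Matrix n n 𝕜)) L E
    (by rw [hfac]; abel) hE v
  rw [sub_mulVec, dotProduct_sub, map_sub, re_quadForm_smul_one] at h
  linarith

/-- **Certified `λ_max`** (impl-3 `[Gram_B]`/`[Gram_C]`, hence `‖Y‖₂ ≤ √(s + ε)` for a Gram matrix
`G = Y†Y`): `s·1 − G = L Lᴴ + E` with `‖E‖₂ ≤ ε` ⇒ `Re (v† G v) ≤ (s + ε) Σ‖v_i‖²`. [folklore] -/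
theorem re_quadForm_le_of_shift_sub_factor_residual (G L E : Matrix n n 𝕜) {s ε : ℝ}
    (hfac : ((s : 𝕜) • (1 : Matrix n n 𝕜)) - G = L * Lᴴ + E) (hE : ‖E‖ ≤ ε) (v : n → 𝕜) :
    RCLike.re (star v ⬝ᵥ G *ᵥ v) ≤ (s + ε) * ∑ i, ‖v i‖ ^ 2 := by
  have h := re_quadForm_ge_neg_of_factor_residual (((s : 𝕜) • (1 : Matrix n n 𝕜)) - G) L E hfac hE v
  rw [sub_mulVec, dotProduct_sub, map_sub, re_quadForm_smul_one] at h
  linarith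

end FactorResidual

end Summit.NavierStokesRegularity.FluidComputer.CertifierNormBounds
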